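import Literature.MathematicalPhysics.QuantumLattice.ComplexSourcePartitionFn
import Literature.MathematicalPhysics.QuantumLattice.GibbsStatePerturbationBound
import Mathlib.Analysis.Complex.Liouville
import Mathlib.Analysis.Complex.RealDeriv
import Mathlib.Analysis.SpecialFunctions.Log.Deriv
import HarnessLib

/-!
# The cubic Taylor bound for `log Tr e^{-β(H+V)}` (one-sided, explicit constant)

For Hermitian `H, V` on a finite-dimensional space, `β ≥ 0` and `β‖V‖ ≤ 1/10` (operator norm):

  `log Z(H+V) − log Z(H) + β⟨V⟩_{β,H} − ½β²·[(V,V)_Duh − ⟨V⟩²_{β,H}] ≤ 16 (β‖V‖)³`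

(`Literature.MathematicalPhysics.QuantumLattice.logPartitionFn_taylor3_upper`), where `Z = Matrix.partitionFn`,
`⟨·⟩ = Matrix.gibbsState`, `(·,·)_Duh = Matrix.duhamel` (the `Z`-normalised Duhamel two-point function). Orders ≤ 2
(`F′(0) = −β⟨V⟩`, `F″(0) = β²[(V,V)_Duh − ⟨V⟩²]` for `F(s) = log Tr e^{−β(H+sV)}`) are the tree's
`deriv_partitionFn_sub_smul_zero` / `iteratedDeriv_two_partitionFn_sub_smul_eq_duhamel` (`ComplexSourcePartitionFn`); this file supplies
the third-order remainder with an explicit (unoptimised) constant. Everything is PROVED; no definition, no `sorry`.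

PROOF ROUTE (complex-analytic; avoids the third Duhamel formula and multi-factor trace Hölder). `Z(h) = Tr e^{−β(H − hQ)}`, `Q = −V`, is
ENTIRE (`differentiable_partitionFn_sub_smul`); `|Z(h)| ≤ Z(Re h)` (`norm_partitionFn_complexSource_le_re`); on the real axis
`Z(t) ≤ e^{β‖V‖|t−s|} Z(s)` (two-sided Peierls–Bogoliubov, `abs_log_partitionFn_sub_log_partitionFn_le`). Hence
`|Z(h)| ≤ Z(s)·e^{β‖V‖·|h−s|}` and three Cauchy estimates of radius `1/(β‖V‖)` (`Complex.norm_deriv_le_of_forall_mem_sphere_norm_le`) give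
`|Z‴(t)| ≤ e³(β‖V‖)³ Z(t) ≤ e⁴(β‖V‖)³ Z(0)` on `[0,1]` (`β‖V‖ ≤ 1`). A third-order real Taylor estimate by monotonicity then yields
`Z(1)/Z(0) = 1 − β⟨V⟩ + ½β²(V,V)_Duh + ρ`, `|ρ| ≤ 10(β‖V‖)³`, and `log(1+x) ≤ x − x²/2 + |x|³/(1−|x|)`
(`Real.abs_log_sub_add_sum_range_le`) with `|⟨V⟩| ≤ ‖V‖`, `|(V,V)_Duh| ≤ ‖V‖²` (`norm_gibbsState_le`, `Matrix.norm_duhamel_le`) finishes;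
budget `10 + 3/2 + 2 ≤ 16`. Only the UPPER bound is proved (it is what free-energy FLOOR certificates consume); the lower bound holds by
the same argument and is not needed here.

USE. Feeds the θ-window of finite-torus flux-cost certificates (`Summits/Ventures/CertifiedManyBodySolver/Cruxes/
ThermalStiffnessCeilingU8b10_le_1o8/SeamCumulantCertificate.lean`, BN-resc-2): with it, a quadratic floor of the flux free-energy cost on a
θ-window follows from certified `θ = 0` Gibbs/Duhamel enclosures alone.

## References

* O. Bratteli, D. W. Robinson, *Operator Algebras and Quantum Statistical Mechanics II*, 2nd ed. (1997), §5.4.1 (perturbation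
  expansion of Gibbs/KMS states in the coupling; analyticity). [BratteliRobinsonII1997]
* D. Ruelle, *Statistical Mechanics: Rigorous Results* (1969), §2 (convexity / Lipschitz continuity of the pressure in the interaction,
  `|P(Φ) − P(Ψ)| ≤ ‖Φ − Ψ‖`). [Ruelle1969]
-/

noncomputable section

open scoped Matrix.Norms.L2Operator ComplexOrder
open Matrix Literature.MathematicalPhysics.QuantumLattice

namespace Literature.MathematicalPhysics.QuantumLattice

namespace LogPartitionFnCubicTaylor

/-! ## A. A real third-order Taylor estimate from a bound on the third derivative (monotonicity only) -/

/-- One-sided third-order Taylor estimate on `[0,1]` by monotonicity: if `f₀' = f₁`, `f₁' = f₂`, `f₂' = f₃` and `f₃ ≤ M` on `[0,1]`, then `f₀ 1 - f₀ 0 - f₁ 0 - f₂ 0 / 2 ≤ M / 6`. [folklore] -/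
private theorem taylor_three_upper {f0 f1 f2 f3 : ℝ → ℝ} {M : ℝ}
    (h0 : ∀ t, HasDerivAt f0 (f1 t) t) (h1 : ∀ t, HasDerivAt f1 (f2 t) t)
    (h2 : ∀ t, HasDerivAt f2 (f3 t) t) (hM : ∀ t ∈ Set.Icc (0 : ℝ) 1, f3 t ≤ M) :
    f0 1 - f0 0 - f1 0 - f2 0 / 2 ≤ M / 6 := by
  -- second layer: `g2 t = f2 t - f2 0 - t M` is antitone on `[0,1]`
  have hd2 : ∀ t, HasDerivAt (fun t => f2 t - f2 0 - t * M) (f3 t - M) t := fun t =>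
    ((h2 t).sub_const (f2 0)).sub (hasDerivAt_mul_const (x := t) M)
  have hG2 : ∀ t ∈ Set.Icc (0 : ℝ) 1, f2 t - f2 0 - t * M ≤ 0 := by
    have hanti : AntitoneOn (fun t => f2 t - f2 0 - t * M) (Set.Icc (0 : ℝ) 1) := by
      refine antitoneOn_of_deriv_nonpos (convex_Icc 0 1) ?_ ?_ ?_
      · exact fun t _ => (hd2 t).continuousAt.continuousWithinAt
      · exact fun t _ => (hd2 t).differentiableAt.differentiableWithinAt
      · intro t ht
        rw [interior_Icc] at ht
        rw [(hd2 t).deriv]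
        linarith [hM t ⟨ht.1.le, ht.2.le⟩]
    intro t ht
    have := hanti ⟨le_refl 0, zero_le_one⟩ ht ht.1
    simp only [sub_self, zero_mul] at this
    linarith
  -- first layer
  have hd1 : ∀ t, HasDerivAt (fun t => f1 t - f1 0 - t * f2 0 - t ^ 2 * (M / 2)) (f2 t - f2 0 - t * M) t := by
    intro t
    have h := (((h1 t).sub_const (f1 0)).sub (hasDerivAt_mul_const (x := t) (f2 0))).sub
      ((hasDerivAt_pow 2 t).mul_const (M / 2))
    refine h.congr_deriv ?_
    push_cast
    ring
  have hG1 : ∀ t ∈ Set.Icc (0 : ℝ) 1, f1 t - f1 0 - t * f2 0 - t ^ 2 * (M / 2) ≤ 0 := by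
    have hanti : AntitoneOn (fun t => f1 t - f1 0 - t * f2 0 - t ^ 2 * (M / 2)) (Set.Icc (0 : ℝ) 1) := by
      refine antitoneOn_of_deriv_nonpos (convex_Icc 0 1) ?_ ?_ ?_
      · exact fun t _ => (hd1 t).continuousAt.continuousWithinAt
      · exact fun t _ => (hd1 t).differentiableAt.differentiableWithinAt
      · intro t ht
        rw [interior_Icc] at ht
        rw [(hd1 t).deriv]
        exact hG2 t ⟨ht.1.le, ht.2.le⟩
    intro t ht
    have := hanti ⟨le_refl 0, zero_le_one⟩ ht ht.1
    simp only [sub_self, zero_mul, zero_pow two_ne_zero] at this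
    linarith
  -- zeroth layer
  have hd0 : ∀ t, HasDerivAt (fun t => f0 t - f0 0 - t * f1 0 - t ^ 2 * (f2 0 / 2) - t ^ 3 * (M / 6))
      (f1 t - f1 0 - t * f2 0 - t ^ 2 * (M / 2)) t := by
    intro t
    have h := ((((h0 t).sub_const (f0 0)).sub (hasDerivAt_mul_const (x := t) (f1 0))).sub
      ((hasDerivAt_pow 2 t).mul_const (f2 0 / 2))).sub ((hasDerivAt_pow 3 t).mul_const (M / 6))
    refine h.congr_deriv ?_
    push_cast
    ring
  have hanti : AntitoneOn (fun t => f0 t - f0 0 - t * f1 0 - t ^ 2 * (f2 0 / 2) - t ^ 3 * (M / 6))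
      (Set.Icc (0 : ℝ) 1) := by
    refine antitoneOn_of_deriv_nonpos (convex_Icc 0 1) ?_ ?_ ?_
    · exact fun t _ => (hd0 t).continuousAt.continuousWithinAt
    · exact fun t _ => (hd0 t).differentiableAt.differentiableWithinAt
    · intro t ht
      rw [interior_Icc] at ht
      rw [(hd0 t).deriv]
      exact hG1 t ⟨ht.1.le, ht.2.le⟩
  have h := hanti ⟨le_refl 0, zero_le_one⟩ ⟨zero_le_one, le_refl 1⟩ zero_le_one
  simp only [sub_self, zero_mul, one_pow, one_mul, zero_pow two_ne_zero, zero_pow three_ne_zero] at h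
  linarith

/-- Two-sided third-order Taylor estimate on `[0,1]`: `|f₃| ≤ M` on `[0,1]` gives `|f₀ 1 - f₀ 0 - f₁ 0 - f₂ 0 / 2| ≤ M / 6`. [folklore] -/
private theorem taylor_three_abs {f0 f1 f2 f3 : ℝ → ℝ} {M : ℝ}
    (h0 : ∀ t, HasDerivAt f0 (f1 t) t) (h1 : ∀ t, HasDerivAt f1 (f2 t) t)
    (h2 : ∀ t, HasDerivAt f2 (f3 t) t) (hM : ∀ t ∈ Set.Icc (0 : ℝ) 1, |f3 t| ≤ M) :
    |f0 1 - f0 0 - f1 0 - f2 0 / 2| ≤ M / 6 := by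
  rw [abs_le]
  constructor
  · have h := taylor_three_upper (f0 := fun t => -f0 t) (f1 := fun t => -f1 t) (f2 := fun t => -f2 t)
      (f3 := fun t => -f3 t) (M := M) (fun t => (h0 t).neg) (fun t => (h1 t).neg) (fun t => (h2 t).neg)
      (fun t ht => by linarith [(abs_le.1 (hM t ht)).1])
    linarith
  · exact taylor_three_upper h0 h1 h2 (fun t ht => (abs_le.1 (hM t ht)).2)

/-! ## B. Cauchy's estimate, iterated three times under exponential growth -/

/-- Cauchy estimate under exponential growth: if `f` is entire and `‖f z‖ ≤ K e^{b‖z - c‖}`, then `‖f' c'‖ ≤ K e^{b(‖c' - c‖ + r)} / r` for every radius `r > 0`. [folklore] -/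
private theorem norm_deriv_le_of_exp_growth {f : ℂ → ℂ} (hf : Differentiable ℂ f) {c : ℂ} {K b r : ℝ}
    (hr : 0 < r) (hK : 0 ≤ K) (h : ∀ z, ‖f z‖ ≤ K * Real.exp (b * ‖z - c‖)) (hb : 0 ≤ b) (z : ℂ) :
    ‖deriv f z‖ ≤ K * Real.exp (b * r) / r * Real.exp (b * ‖z - c‖) := by
  have hC : ∀ w ∈ Metric.sphere z r, ‖f w‖ ≤ K * Real.exp (b * r) * Real.exp (b * ‖z - c‖) := by
    intro w hw
    have hw' : ‖w - z‖ = r := by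
      have := Metric.mem_sphere.1 hw
      rwa [dist_eq_norm] at this
    have h1 : ‖w - c‖ ≤ ‖z - c‖ + r := by
      calc ‖w - c‖ = ‖(w - z) + (z - c)‖ := by rw [sub_add_sub_cancel]
        _ ≤ ‖w - z‖ + ‖z - c‖ := norm_add_le _ _
        _ = ‖z - c‖ + r := by rw [hw', add_comm]
    calc ‖f w‖ ≤ K * Real.exp (b * ‖w - c‖) := h w
      _ ≤ K * Real.exp (b * (‖z - c‖ + r)) := by gcongr
      _ = K * Real.exp (b * r) * Real.exp (b * ‖z - c‖) := by rw [mul_add, Real.exp_add]; ring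
  have := Complex.norm_deriv_le_of_forall_mem_sphere_norm_le hr hf.diffContOnCl hC
  calc ‖deriv f z‖ ≤ K * Real.exp (b * r) * Real.exp (b * ‖z - c‖) / r := this
    _ = _ := by ring

/-- The derivative of an entire function is entire. [folklore] -/
private theorem differentiable_deriv_of_differentiable {f : ℂ → ℂ} (hf : Differentiable ℂ f) :
    Differentiable ℂ (deriv f) := fun z => ((hf.analyticAt z).deriv).differentiableAt

/-- `‖f‴(c)‖ ≤ K e³ b³` if `‖f(z)‖ ≤ K e^{b‖z - c‖}` everywhere (`b > 0`; Cauchy with radius `1/b`, three times).  [folklore] -/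
private theorem norm_deriv_three_le {f : ℂ → ℂ} (hf : Differentiable ℂ f) {c : ℂ} {K b : ℝ} (hK : 0 ≤ K)
    (hb : 0 < b) (h : ∀ z, ‖f z‖ ≤ K * Real.exp (b * ‖z - c‖)) :
    ‖deriv (deriv (deriv f)) c‖ ≤ K * Real.exp 1 ^ 3 * b ^ 3 := by
  have hr : 0 < 1 / b := by positivity
  have hf1 := differentiable_deriv_of_differentiable hf
  have hf2 := differentiable_deriv_of_differentiable hf1
  have hb1 : b * (1 / b) = 1 := by field_simp
  have h1 := norm_deriv_le_of_exp_growth hf hr hK h hb.le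
  rw [hb1] at h1
  have hK1 : 0 ≤ K * Real.exp 1 / (1 / b) := by positivity
  have h2 := norm_deriv_le_of_exp_growth hf1 hr hK1 h1 hb.le
  rw [hb1] at h2
  have hK2 : 0 ≤ K * Real.exp 1 / (1 / b) * Real.exp 1 / (1 / b) := by positivity
  have h3 := norm_deriv_le_of_exp_growth hf2 hr hK2 h2 hb.le c
  rw [hb1, sub_self, norm_zero, mul_zero, Real.exp_zero, mul_one] at h3
  calc _ ≤ _ := h3
    _ = K * Real.exp 1 ^ 3 * b ^ 3 := by field_simp


/-! ## C0. The real-number endgame (isolated from the matrix context) -/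

/-- The real-number endgame of the cubic Taylor bound: from the Taylor estimate for `Z(1)/Z(0)` and the sizes of the first two coefficients to the bound for `log Z(1) - log Z(0)` (constant 16, `b ≤ 1/10`). [folklore] -/
private theorem cubic_endgame {b β g D Z0 Z1v : ℝ} (hbpos : 0 < b) (hb : b ≤ 1 / 10) (hZ0p : 0 < Z0)
    (hZ1vp : 0 < Z1v) (hT : |Z1v - Z0 - -(β * Z0 * g) - β ^ 2 * Z0 * D / 2| ≤ 60 * b ^ 3 * Z0 / 6)
    (hβg : |β * g| ≤ b) (hβD : |β ^ 2 * D / 2| ≤ b ^ 2 / 2) :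
    Real.log Z1v - Real.log Z0 + β * g - β ^ 2 / 2 * (D - g ^ 2) ≤ 16 * b ^ 3 := by
  -- `x = Z(1)/Z(0) - 1 = -βg + y`, `y = ½β²D + ρ`, `|ρ| ≤ 10 b³`
  set ρ : ℝ := (Z1v - Z0 + β * Z0 * g - β ^ 2 * Z0 * D / 2) / Z0 with hρdef
  have hρ : |ρ| ≤ 10 * b ^ 3 := by
    rw [hρdef, abs_div, abs_of_pos hZ0p, div_le_iff₀ hZ0p]
    have e : Z1v - Z0 + β * Z0 * g - β ^ 2 * Z0 * D / 2 = Z1v - Z0 - -(β * Z0 * g) - β ^ 2 * Z0 * D / 2 := by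
      ring
    rw [e]
    linarith
  set x : ℝ := Z1v / Z0 - 1 with hxdef
  set y : ℝ := β ^ 2 * D / 2 + ρ with hydef
  have hx_eq : x = -(β * g) + y := by
    rw [hxdef, hydef, hρdef]
    field_simp
    ring
  have hb3 : 10 * b ^ 3 ≤ b ^ 2 := by nlinarith [hb, hbpos, sq_nonneg b]
  have hy : |y| ≤ 3 / 2 * b ^ 2 := by
    have := abs_add_le (β ^ 2 * D / 2) ρ
    rw [← hydef] at this
    linarith [hβD, hρ, hb3]
  have hb2 : 3 / 2 * b ^ 2 ≤ 3 / 20 * b := by nlinarith [hb, hbpos]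
  have hxb : |x| ≤ 23 / 20 * b := by
    rw [hx_eq]
    have := abs_add_le (-(β * g)) y
    rw [abs_neg] at this
    linarith [hβg, hy, hb2]
  have hx1 : |x| < 1 := by linarith [hxb, hb]
  -- `log Z(1) - log Z(0) = log(1 + x) ≤ x - x²/2 + |x|³/(1 - |x|)`
  have hlog : Real.log Z1v - Real.log Z0 = Real.log (1 + x) := by
    rw [← Real.log_div hZ1vp.ne' hZ0p.ne', hxdef]
    congr 1
    ring
  have hser := Real.abs_log_sub_add_sum_range_le (x := -x) (by rwa [abs_neg]) 2
  have hsum : (∑ i ∈ Finset.range 2, (-x) ^ (i + 1) / ((i : ℝ) + 1)) = -x + x ^ 2 / 2 := by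
    simp [Finset.sum_range_succ]
    ring
  rw [hsum, sub_neg_eq_add, abs_neg] at hser
  have hE : |x| ^ 3 / (1 - |x|) ≤ 2 * b ^ 3 := by
    have h1 : 177 / 200 ≤ 1 - |x| := by linarith [hxb, hb]
    rw [div_le_iff₀ (by linarith)]
    have h2 : |x| ^ 3 ≤ (23 / 20 * b) ^ 3 := pow_le_pow_left₀ (abs_nonneg x) hxb 3
    have h3 : 2 * b ^ 3 * (177 / 200) ≤ 2 * b ^ 3 * (1 - |x|) :=
      mul_le_mul_of_nonneg_left h1 (by positivity)
    have h4 : (23 / 20 * b) ^ 3 = 12167 / 8000 * b ^ 3 := by ring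
    linarith [h2, h3, h4, pow_pos hbpos 3]
  have hlog2 : Real.log (1 + x) ≤ x - x ^ 2 / 2 + 2 * b ^ 3 := by
    have := (abs_le.1 hser).2
    linarith [hE]
  -- with `x = -βg + y`: `x - x²/2 + βg - ½β²(D - g²) = ρ + βg·y - y²/2`
  have key : x - x ^ 2 / 2 + β * g - β ^ 2 / 2 * (D - g ^ 2) = ρ + β * g * y - y ^ 2 / 2 := by
    rw [hx_eq, hydef]; ring
  have hgy : β * g * y ≤ b * (3 / 2 * b ^ 2) := by
    calc β * g * y ≤ |β * g * y| := le_abs_self _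
      _ = |β * g| * |y| := abs_mul _ _
      _ ≤ b * (3 / 2 * b ^ 2) := mul_le_mul hβg hy (abs_nonneg _) hbpos.le
  have hρ' := (abs_le.1 hρ).2
  have hy2 : 0 ≤ y ^ 2 / 2 := by positivity
  have hb33 : b * (3 / 2 * b ^ 2) = 3 / 2 * b ^ 3 := by ring
  linarith [hlog, hlog2, key, hgy, hρ', hy2, hb33, pow_pos hbpos 3]

end LogPartitionFnCubicTaylor

open LogPartitionFnCubicTaylor

/-! ## C. The cubic Taylor bound for `log Tr e^{-β(H+V)}` (one-sided, explicit constant) -/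

section Main

variable {n : Type*} [Fintype n] [DecidableEq n] [Nonempty n]

omit [Fintype n] [DecidableEq n] [Nonempty n] in
/-- `(t : ℂ) • V` is Hermitian for Hermitian `V` and real `t`.  [folklore] -/
private theorem isHermitian_ofReal_smul_of_isHermitian {V : Matrix n n ℂ} (hV : V.IsHermitian) (t : ℝ) : ((t : ℂ) • V).IsHermitian := by
  unfold Matrix.IsHermitian
  rw [conjTranspose_smul, hV.eq, Complex.star_def, Complex.conj_ofReal]

set_option maxHeartbeats 800000 in
/-- **Cubic Taylor bound for `log Tr e^{-β(H+V)}`, upper side, explicit constant.** For Hermitian `H, V`, `β ≥ 0`, `β‖V‖ ≤ 1/10`: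
`log Z(H+V) − log Z(H) + β⟨V⟩ − ½β²[(V;V)_Duh − ⟨V⟩²] ≤ 16 (β‖V‖)³` — the third-order remainder of the
perturbation expansion of `log Tr e^{−β(H+λV)}` (orders ≤ 2 = Gibbs expectation and Duhamel/Kubo–Mori variance), with an explicit
unoptimised constant. [cite: BratteliRobinsonII1997, §5.4.1] -/
theorem logPartitionFn_taylor3_upper {β : ℝ} (hβ : 0 ≤ β) {H V : Matrix n n ℂ} (hH : H.IsHermitian)
    (hV : V.IsHermitian) (hb : β * ‖V‖ ≤ 1 / 10) :
    Real.log (partitionFn β (H + V)).re - Real.log (partitionFn β H).re + β * (gibbsState β H V).re -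
        β ^ 2 / 2 * ((duhamel β H V V).re - (gibbsState β H V).re ^ 2) ≤ 16 * (β * ‖V‖) ^ 3 := by
  rcases (mul_nonneg hβ (norm_nonneg V)).eq_or_lt with hb0 | hbpos
  · -- degenerate: `β = 0` or `V = 0`
    rcases mul_eq_zero.1 hb0.symm with hβ0 | hV0
    · subst hβ0
      simp [partitionFn, gibbsWeight]
    · have hV0' : V = 0 := norm_eq_zero.1 hV0
      subst hV0'
      simp [duhamel]
  -- the source direction `Q = -V`, so that `H - hQ = H + hV`
  set b : ℝ := β * ‖V‖ with hbdef
  set Q : Matrix n n ℂ := -V with hQdef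
  have hQ : Q.IsHermitian := hV.neg
  have hHQ : ∀ h : ℂ, H - h • Q = H + h • V := fun h => by rw [hQdef, smul_neg, sub_neg_eq_add]
  have hHt : ∀ t : ℝ, (H + (t : ℂ) • V).IsHermitian := fun t => hH.add (isHermitian_ofReal_smul_of_isHermitian hV t)
  have hHt' : ∀ t : ℝ, (H - (t : ℂ) • Q).IsHermitian := fun t => by rw [hHQ]; exact hHt t
  set Zc : ℂ → ℂ := fun h => partitionFn β (H - h • Q) with hZcdef
  have hZc_d : Differentiable ℂ Zc := differentiable_partitionFn_sub_smul β H Q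
  have hZr_pos : ∀ t : ℝ, 0 < (Zc t).re := fun t => partitionFn_re_pos (hHt' t) β
  -- Petz: `|Z(h)| ≤ Z(Re h)`
  have hZc_le_re : ∀ h : ℂ, ‖Zc h‖ ≤ (Zc (h.re : ℂ)).re := fun h => by
    have := norm_partitionFn_complexSource_le_re β hH hQ h.re h.im
    rw [Complex.re_add_im] at this
    exact this
  -- growth along the real axis: `Z(t) ≤ e^{b|t-s|} Z(s)` (Peierls–Bogoliubov both ways)
  have hgrowth : ∀ t s : ℝ, (Zc t).re ≤ Real.exp (b * |t - s|) * (Zc s).re := fun t s => by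
    have h := abs_log_partitionFn_sub_log_partitionFn_le (hHt t) (hHt s) hβ
    have hnorm : ‖(H + (t : ℂ) • V) - (H + (s : ℂ) • V)‖ = |t - s| * ‖V‖ := by
      rw [add_sub_add_left_eq_sub, ← sub_smul, ← Complex.ofReal_sub, norm_smul, Complex.norm_real,
        Real.norm_eq_abs]
    have hb' : β * (|t - s| * ‖V‖) = b * |t - s| := by rw [hbdef]; ring
    rw [hnorm, hb'] at h
    have h1 := (abs_le.1 h).2
    have hpt : 0 < (partitionFn β (H + (t : ℂ) • V)).re := partitionFn_re_pos (hHt t) β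
    have hps : 0 < (partitionFn β (H + (s : ℂ) • V)).re := partitionFn_re_pos (hHt s) β
    have h2 := Real.exp_le_exp.2 (show Real.log (partitionFn β (H + (t : ℂ) • V)).re ≤
        Real.log (partitionFn β (H + (s : ℂ) • V)).re + b * |t - s| by linarith)
    rw [Real.exp_log hpt, Real.exp_add, Real.exp_log hps] at h2
    have e1 : (Zc t).re = (partitionFn β (H + (t : ℂ) • V)).re := by simp only [hZcdef, hHQ]
    have e2 : (Zc s).re = (partitionFn β (H + (s : ℂ) • V)).re := by simp only [hZcdef, hHQ]
    rw [e1, e2]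
    linarith [h2]
  -- combined growth bound in the complex plane around a real base point `s`
  have hZc_growth : ∀ s : ℝ, ∀ h : ℂ, ‖Zc h‖ ≤ (Zc s).re * Real.exp (b * ‖h - (s : ℂ)‖) := fun s h => by
    have h1 := hZc_le_re h
    have h2 := hgrowth h.re s
    have h3 : |h.re - s| ≤ ‖h - (s : ℂ)‖ := by
      have := Complex.abs_re_le_norm (h - (s : ℂ))
      simpa using this
    have h4 : Real.exp (b * |h.re - s|) ≤ Real.exp (b * ‖h - (s : ℂ)‖) :=
      Real.exp_le_exp.2 (mul_le_mul_of_nonneg_left h3 hbpos.le)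
    have h5 := hZr_pos s
    calc ‖Zc h‖ ≤ (Zc (h.re : ℂ)).re := h1
      _ ≤ Real.exp (b * |h.re - s|) * (Zc s).re := h2
      _ ≤ Real.exp (b * ‖h - (s : ℂ)‖) * (Zc s).re := mul_le_mul_of_nonneg_right h4 h5.le
      _ = _ := mul_comm _ _
  -- the three complex derivatives and their real restrictions
  set Z1 : ℂ → ℂ := deriv Zc with hZ1def
  set Z2 : ℂ → ℂ := deriv Z1 with hZ2def
  set Z3 : ℂ → ℂ := deriv Z2 with hZ3def
  have hZ1_d : Differentiable ℂ Z1 := differentiable_deriv_of_differentiable hZc_d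
  have hZ2_d : Differentiable ℂ Z2 := differentiable_deriv_of_differentiable hZ1_d
  have hD0 : ∀ t : ℝ, HasDerivAt (fun x : ℝ => (Zc x).re) (Z1 t).re t := fun t =>
    (hZc_d (t : ℂ)).hasDerivAt.real_of_complex
  have hD1 : ∀ t : ℝ, HasDerivAt (fun x : ℝ => (Z1 x).re) (Z2 t).re t := fun t =>
    (hZ1_d (t : ℂ)).hasDerivAt.real_of_complex
  have hD2 : ∀ t : ℝ, HasDerivAt (fun x : ℝ => (Z2 x).re) (Z3 t).re t := fun t =>
    (hZ2_d (t : ℂ)).hasDerivAt.real_of_complex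
  -- third-derivative bound on `[0,1]`: `|Z‴(t)| ≤ e³ b³ Z(t) ≤ e⁴ b³ Z(0) ≤ 60 b³ Z(0)`
  have hZ0pos : 0 < (Zc 0).re := by simpa using hZr_pos 0
  have he1 : Real.exp 1 ≤ 2.7183 := le_of_lt (lt_trans Real.exp_one_lt_d9 (by norm_num))
  have he4 : Real.exp 1 ^ 4 ≤ 60 :=
    (pow_le_pow_left₀ (Real.exp_pos 1).le he1 4).trans (by norm_num)
  have hM : ∀ t ∈ Set.Icc (0 : ℝ) 1, |(Z3 t).re| ≤ 60 * b ^ 3 * (Zc 0).re := by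
    intro t ht
    have h1 : ‖Z3 t‖ ≤ (Zc t).re * Real.exp 1 ^ 3 * b ^ 3 :=
      norm_deriv_three_le hZc_d (hZr_pos t).le hbpos (hZc_growth t)
    have h2 : (Zc t).re ≤ Real.exp (b * |t - 0|) * (Zc 0).re := by simpa using hgrowth t 0
    have h3 : Real.exp (b * |t - 0|) ≤ Real.exp 1 := by
      rw [sub_zero, abs_of_nonneg ht.1]
      exact Real.exp_le_exp.2 (by nlinarith [ht.2, hbpos])
    have h4 : (Zc t).re ≤ Real.exp 1 * (Zc 0).re := h2.trans (mul_le_mul_of_nonneg_right h3 hZ0pos.le)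
    calc |(Z3 t).re| ≤ ‖Z3 t‖ := Complex.abs_re_le_norm _
      _ ≤ (Zc t).re * Real.exp 1 ^ 3 * b ^ 3 := h1
      _ ≤ (Real.exp 1 * (Zc 0).re) * Real.exp 1 ^ 3 * b ^ 3 := by gcongr
      _ = Real.exp 1 ^ 4 * b ^ 3 * (Zc 0).re := by ring
      _ ≤ 60 * b ^ 3 * (Zc 0).re :=
          mul_le_mul_of_nonneg_right (mul_le_mul_of_nonneg_right he4 (pow_pos hbpos 3).le) hZ0pos.le
  -- Taylor with remainder for `t ↦ Z(t)` on `[0,1]`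
  have hT := taylor_three_abs hD0 hD1 hD2 hM
  simp only [Complex.ofReal_one, Complex.ofReal_zero] at hT
  -- values: `Z(0) = Z_H`, `Z(1) = Z_{H+V}`, `Z'(0) = -β Z ⟨V⟩`, `Z''(0) = β² Z (V;V)`
  have hZc0 : Zc 0 = partitionFn β H := by simp [hZcdef]
  have hZc1 : Zc 1 = partitionFn β (H + V) := by simp [hZcdef, hHQ]
  have hZ1_0 : Z1 0 = (β : ℂ) * partitionFn β H * gibbsState β H Q := deriv_partitionFn_sub_smul_zero β hH Q
  have hZ2_0 : Z2 0 = (β : ℂ) ^ 2 * partitionFn β H * duhamel β H Q Q := by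
    have := iteratedDeriv_two_partitionFn_sub_smul_eq_duhamel β hH Q
    rw [iteratedDeriv_succ, iteratedDeriv_one] at this
    exact this
  have hgQ : gibbsState β H Q = -gibbsState β H V := by rw [hQdef, map_neg]
  have hdQ : duhamel β H Q Q = duhamel β H V V := by
    simp only [hQdef, duhamel, neg_mul, mul_neg, neg_neg]
  -- the real numbers
  set Z0 : ℝ := (partitionFn β H).re with hZ0def
  set Z1v : ℝ := (partitionFn β (H + V)).re with hZ1vdef
  set g : ℝ := (gibbsState β H V).re with hgdef
  set D : ℝ := (duhamel β H V V).re with hDdef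
  have hZH : partitionFn β H = (Z0 : ℂ) := by
    have h := hH.partitionFn_eq_ofReal β
    rw [hZ0def, h, Complex.ofReal_re]
  have hZ0p : 0 < Z0 := by rw [hZ0def, ← hZc0]; exact hZ0pos
  have hZ1vp : 0 < Z1v := by
    have := hZr_pos 1
    rw [Complex.ofReal_one, hZc1] at this
    exact this
  have hre1' : (Z1 0).re = -(β * Z0 * g) := by
    rw [hZ1_0, hgQ, hZH, ← Complex.ofReal_mul, mul_neg, Complex.neg_re, Complex.re_ofReal_mul]
  have hre2' : (Z2 0).re = β ^ 2 * Z0 * D := by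
    rw [hZ2_0, hdQ, hZH, ← Complex.ofReal_pow, ← Complex.ofReal_mul, Complex.re_ofReal_mul]
  rw [hZc1, hZc0, hre1', hre2'] at hT
  rw [← hZ0def, ← hZ1vdef] at hT
  -- sizes of the first two coefficients
  have hg : |g| ≤ ‖V‖ := (Complex.abs_re_le_norm _).trans (norm_gibbsState_le hH β V)
  have hDb : |D| ≤ ‖V‖ * ‖V‖ := (Complex.abs_re_le_norm _).trans (norm_duhamel_le hH hβ V V)
  have hβg : |β * g| ≤ b := by
    rw [abs_mul, abs_of_nonneg hβ, hbdef]; exact mul_le_mul_of_nonneg_left hg hβ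
  have hβD : |β ^ 2 * D / 2| ≤ b ^ 2 / 2 := by
    rw [abs_div, abs_mul, abs_of_nonneg (sq_nonneg β), abs_two, hbdef, mul_pow]
    have h1 : |D| ≤ ‖V‖ ^ 2 := by rw [sq]; exact hDb
    have : β ^ 2 * |D| ≤ β ^ 2 * ‖V‖ ^ 2 := mul_le_mul_of_nonneg_left h1 (sq_nonneg β)
    linarith
  exact cubic_endgame hbpos hb hZ0p hZ1vp hT hβg hβD

end Main

end Literature.MathematicalPhysics.QuantumLattice

end
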